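import Mathlib
import HarnessLib

/-!
# Plane-wave extraction of a Fourier mode from the Faddeev–Popov inequality (Zwanziger)

Support file (everything PROVED, no definition, no named fact) for Zwanziger's Gribov-region
support bound in the minimal lattice Coulomb gauge (route `ConvexGribovBody` of
`QuantumFields/YangMills`, crux `CovarianceBound`; companion of `CoulombGaugeFPPositivity.lean`,
from which it is deliberately import-independent).

## Content

On the spatial torus `Λ = (ℤ/L)³` with links `(y, j) ↦ (y, y + e_j)` fix real link weights
`m (y, j)` (in the application: `Re tr(W_{y,j} [X, Y])` for the gauge-fixed link variables) and
suppose the **FP inequality**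

  `|∑_{(y,j)} (φ(y+e_j)ψ(y) - ψ(y+e_j)φ(y)) m(y,j)| ≤ K ∑_{(y,j)} ((Δ_jφ)(y)² + (Δ_jψ)(y)²)`

for all real test functions `φ, ψ` (hypothesis `H`; it holds at every minimum of the lattice
Coulomb-gauge functional, `CoulombGaugeFPPositivity.abs_sum_pairing_le`). Testing with the plane
waves `φ = cos(θ + α)`, `ψ = cos(θ - ϖ + α')`, where `ϖ` is the phase of momentum `p`
(`ϖ(y + e_j) ≡ ϖ(y) + σ_j`) and `θ` the phase of momentum `±(2π/L)e_a`, product-to-sum formulas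
isolate the MID-LINK cosine mode `∑_y cos(ϖ(y) + σ_a/2) m(y,a)` of polarisation `a`:

* `abs_pairing_le` : `|T(α, α')| ≤ 9 K L³ ν δ` for the antisymmetrised pairing `T` of the two
  waves, whenever `|κ_j| ≤ δ` (shift of `θ`) and `δ² + 4 sin²(σ_j/2) ≤ ν²` (gradient costs,
  optimised scaling `φ ↦ (ν/δ)φ`);
* `pairing_add_pairing_eq` : `T(α, α - π/2) + T(α + π/2, α) = -2 ∑_j sin(κ_j - σ_j/2) Ĉ_j`
  (the momentum-`(κ + κ')` part cancels, the momentum-`p` part is the mid-link cosine mode);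
* `abs_sum_cos_mul_le` : for `L ≥ 3` and `|cos(σ_a/2)| ≥ 1/2`,
  `|Ĉ_a| = |∑_y cos(ϖ y + σ_a/2) m(y,a)| ≤ 9 K L⁴ ν (2π/L)` (subtract the tests at `±(2π/L)e_a`:
  the weights differ only at `j = a`, by `2 sin(2π/L) cos(σ_a/2) ≥ 2/L · 1/2 · 2`).

Also recorded: the trigonometric toolkit (`cos_shift_mul_cos_sub`, `abs_cos_sub_cos_add_le`,
`abs_sin_sub_le`, `two_div_le_sin_two_pi_div`) and the phase-shift lemma on `(ℤ/L)^d`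
(`exists_phase_shift`).

Source: D. Zwanziger, Nucl. Phys. B 364 (1991) 127 (bound on the gluon field in the Gribov region
of the minimal lattice Coulomb/Landau gauge from positivity of the Faddeev–Popov operator tested on
plane waves; Appendix); D. Zwanziger, Nucl. Phys. B 412 (1994) 657, Sect. 2.
-/

noncomputable section

open Real Finset
open scoped BigOperators

namespace Literature.MathematicalPhysics.QuantumFieldTheory

namespace CoulombFP

/-! ### Trigonometric toolkit for the plane-wave test functions -/

section Trig

open Real

/-- Product-to-sum bookkeeping for the antisymmetrised pair of shifted plane waves:
`cos(u + (A+B)) cos v - cos(v + (A-B)) cos u = -sin A sin(u - v + B) - sin B sin(u + v + A)`.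
[folklore] -/
theorem cos_shift_mul_cos_sub (u v A B : ℝ) :
    cos (u + (A + B)) * cos v - cos (v + (A - B)) * cos u =
      -(sin A * sin (u - v + B)) - sin B * sin (u + v + A) := by
  simp only [cos_add, cos_sub, sin_add, sin_sub]
  ring

/-- `|cos a - cos(a + d)| ≤ 2 |sin(d/2)|`. [folklore] -/
theorem abs_cos_sub_cos_add_le (a d : ℝ) : |cos a - cos (a + d)| ≤ 2 * |sin (d / 2)| := by
  rw [cos_sub_cos]
  have h1 : |sin ((a + (a + d)) / 2)| ≤ 1 := abs_sin_le_one _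
  have h2 : sin ((a - (a + d)) / 2) = -sin (d / 2) := by
    rw [show (a - (a + d)) / 2 = -(d / 2) by ring, sin_neg]
  rw [h2]
  simp only [abs_mul, abs_neg, abs_two]
  nlinarith [abs_nonneg (sin (d / 2))]

/-- `|cos a - cos(a + d)| ≤ |d|` (`cos` is `1`-Lipschitz). [folklore] -/
theorem abs_cos_sub_cos_add_le_abs (a d : ℝ) : |cos a - cos (a + d)| ≤ |d| := by
  refine (abs_cos_sub_cos_add_le a d).trans ?_
  have h := abs_sin_le_abs (x := d / 2)
  rw [abs_div, abs_two] at h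
  linarith

/-- `|sin(x - y)| ≤ |sin x| + |sin y|`. [folklore] -/
theorem abs_sin_sub_le (x y : ℝ) : |sin (x - y)| ≤ |sin x| + |sin y| := by
  rw [sin_sub, sub_eq_add_neg]
  refine (abs_add_le _ _).trans ?_
  rw [abs_neg, abs_mul, abs_mul]
  have hcx := abs_cos_le_one x
  have hcy := abs_cos_le_one y
  nlinarith [abs_nonneg (sin x), abs_nonneg (sin y), abs_nonneg (cos x), abs_nonneg (cos y)]

/-- For `L ≥ 3`: `2/L ≤ sin(2π/L)` (`sin(2π/L) = 2 sin(π/L) cos(π/L)`, Jordan's inequality and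
`cos(π/L) ≥ cos(π/3) = 1/2`). [folklore] -/
theorem two_div_le_sin_two_pi_div {L : ℝ} (hL : 3 ≤ L) : 2 / L ≤ sin (2 * π / L) := by
  have hL0 : 0 < L := by linarith
  have h1 : sin (2 * π / L) = 2 * sin (π / L) * cos (π / L) := by
    rw [show 2 * π / L = 2 * (π / L) by ring, sin_two_mul]
  have hle2 : π / L ≤ π / 2 := div_le_div_of_nonneg_left pi_pos.le two_pos (by linarith)
  have hle3 : π / L ≤ π / 3 := div_le_div_of_nonneg_left pi_pos.le three_pos hL
  have hs : 2 / L ≤ sin (π / L) := by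
    have h := mul_le_sin (x := π / L) (by positivity) hle2
    rwa [show 2 / π * (π / L) = 2 / L by field_simp] at h
  have hc : 1 / 2 ≤ cos (π / L) := by
    rw [← cos_pi_div_three]
    exact cos_le_cos_of_nonneg_of_le_pi (by positivity) (by linarith [pi_pos]) hle3
  have hs0 : 0 ≤ 2 / L := by positivity
  rw [h1]
  nlinarith [mul_le_mul hs hc (by norm_num) (hs0.trans hs)]

end Trig

/-! ### Lattice bookkeeping: plane-wave phases on `(ℤ/L)^d` -/

section Lattice

/-- Shifting a site by `e_j` adds `2π n_j / L` to the plane-wave phase `2π (n · y) / L`, modulo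
`2π` (the wrap-around `y_j = L - 1 ↦ 0` is an integer multiple of `2π` since `n_j ∈ ℤ`).
[folklore] -/
theorem exists_phase_shift {d L : ℕ} [NeZero L] (n : Fin d → ℤ) (y : Fin d → ZMod L) (j : Fin d) :
    ∃ m : ℤ, 2 * Real.pi * (∑ i, (n i : ℝ) * (((y + Pi.single j 1 : Fin d → ZMod L) i).val : ℝ)) / L =
      2 * Real.pi * (∑ i, (n i : ℝ) * ((y i).val : ℝ)) / L + 2 * Real.pi * n j / L +
        m * (2 * Real.pi) := by
  have hL : (L : ℝ) ≠ 0 := Nat.cast_ne_zero.2 (NeZero.ne L)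
  -- the wrapped coordinate
  obtain ⟨k, hk⟩ : ∃ k : ℕ, (((y j + 1 : ZMod L)).val : ℝ) = (y j).val + 1 - L * k := by
    rw [ZMod.val_add, ZMod.val_one_eq_one_mod]
    refine ⟨1 / L + ((y j).val + 1 % L) / L, ?_⟩
    have h1 := Nat.mod_add_div 1 L
    have h2 := Nat.mod_add_div ((y j).val + 1 % L) L
    have h1' : ((1 % L : ℕ) : ℝ) = 1 - (L : ℝ) * ((1 / L : ℕ) : ℝ) := by
      have : ((1 % L : ℕ) : ℝ) + (L : ℝ) * ((1 / L : ℕ) : ℝ) = 1 := by exact_mod_cast h1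
      linarith
    have h2' : ((((y j).val + 1 % L) % L : ℕ) : ℝ) =
        ((y j).val : ℝ) + ((1 % L : ℕ) : ℝ) - (L : ℝ) * ((((y j).val + 1 % L) / L : ℕ) : ℝ) := by
      have : ((((y j).val + 1 % L) % L : ℕ) : ℝ) +
          (L : ℝ) * ((((y j).val + 1 % L) / L : ℕ) : ℝ) = ((y j).val : ℝ) + ((1 % L : ℕ) : ℝ) := by
        exact_mod_cast h2
      linarith
    rw [h2', h1']
    push_cast
    ring
  have hcoord : ∀ i, (((y + Pi.single j 1 : Fin d → ZMod L) i).val : ℝ) =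
      ((y i).val : ℝ) + (if i = j then 1 - (L : ℝ) * k else 0) := by
    intro i
    by_cases hij : i = j
    · subst hij
      rw [Pi.add_apply, Pi.single_eq_same, if_pos rfl, hk]
      ring
    · rw [Pi.add_apply, Pi.single_eq_of_ne hij, add_zero, if_neg hij, add_zero]
  refine ⟨-(n j * k), ?_⟩
  have hsum : (∑ i, (n i : ℝ) * (((y + Pi.single j 1 : Fin d → ZMod L) i).val : ℝ)) =
      (∑ i, (n i : ℝ) * ((y i).val : ℝ)) + n j * (1 - (L : ℝ) * k) := by
    simp_rw [hcoord, mul_add, Finset.sum_add_distrib, mul_ite, mul_zero]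
    rw [Finset.sum_ite_eq' Finset.univ j, if_pos (Finset.mem_univ _)]
  rw [hsum]
  push_cast
  field_simp
  ring

end Lattice

/-! ### Extraction of the mid-link cosine mode from the FP inequality -/

section Extraction

variable {L : ℕ} [NeZero L]

/-- `|(ℤ/L)³ × Fin 3| = 3 L³` (the spatial links of the slice). [folklore] -/
theorem card_slice_links : Fintype.card ((Fin 3 → ZMod L) × Fin 3) = L ^ 3 * 3 := by
  rw [Fintype.card_prod, Fintype.card_fun, ZMod.card, Fintype.card_fin]

/-- Evaluating a `2π`-periodic function at a shifted phase. [folklore] -/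
theorem cos_add_eq_of_exists_shift {a b c : ℝ} (h : ∃ k : ℤ, a = b + c + k * (2 * π)) (x : ℝ) :
    cos (a + x) = cos (b + x + c) := by
  obtain ⟨k, hk⟩ := h
  rw [hk, show b + c + k * (2 * π) + x = (b + x + c) + k * (2 * π) by ring, cos_add_int_mul_two_pi]

omit [NeZero L] in
/-- Shift property of a difference of two lattice phases. [folklore] -/
theorem exists_shift_sub {θ ϖ : (Fin 3 → ZMod L) → ℝ} {κ σ : Fin 3 → ℝ}
    (hθ : ∀ y j, ∃ k : ℤ, θ (y + Pi.single j 1) = θ y + κ j + k * (2 * π))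
    (hϖ : ∀ y j, ∃ k : ℤ, ϖ (y + Pi.single j 1) = ϖ y + σ j + k * (2 * π))
    (y : Fin 3 → ZMod L) (j : Fin 3) :
    ∃ k : ℤ, θ (y + Pi.single j 1) - ϖ (y + Pi.single j 1) =
      (θ y - ϖ y) + (κ j - σ j) + k * (2 * π) := by
  obtain ⟨k, hk⟩ := hθ y j
  obtain ⟨k', hk'⟩ := hϖ y j
  exact ⟨k - k', by rw [hk, hk']; push_cast; ring⟩

/-- **The antisymmetrised two-wave pairing is small.** If the FP inequality `H` holds for all
real test functions, then for the plane waves `φ = cos(θ + α)`, `ψ = cos(θ - ϖ + α')` with shift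
constants `|κ_j| ≤ δ` of `θ` and `σ_j` of `ϖ`, `δ² + 4 sin²(σ_j/2) ≤ ν²`, the pairing
`T = ∑ (φ(y+e_j)ψ(y) - ψ(y+e_j)φ(y)) m(y,j)` obeys `|T| ≤ 9 K L³ ν δ` (apply `H` to
`((ν/δ)φ, ψ)`; the gradient costs are `≤ ν²` and `≤ 2ν²` per link). [cite: Zwanziger1991, Appendix] -/
theorem abs_pairing_le (m : (Fin 3 → ZMod L) × Fin 3 → ℝ) {K : ℝ} (hK : 0 ≤ K)
    (H : ∀ φ ψ : (Fin 3 → ZMod L) → ℝ,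
      |∑ q : (Fin 3 → ZMod L) × Fin 3, (φ (q.1 + Pi.single q.2 1) * ψ q.1 -
          ψ (q.1 + Pi.single q.2 1) * φ q.1) * m q| ≤
        K * ∑ q : (Fin 3 → ZMod L) × Fin 3, ((φ q.1 - φ (q.1 + Pi.single q.2 1)) ^ 2 +
          (ψ q.1 - ψ (q.1 + Pi.single q.2 1)) ^ 2))
    {θ ϖ : (Fin 3 → ZMod L) → ℝ} {κ σ : Fin 3 → ℝ}
    (hθ : ∀ y j, ∃ k : ℤ, θ (y + Pi.single j 1) = θ y + κ j + k * (2 * π))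
    (hϖ : ∀ y j, ∃ k : ℤ, ϖ (y + Pi.single j 1) = ϖ y + σ j + k * (2 * π))
    {δ ν : ℝ} (hδ0 : 0 < δ) (hν0 : 0 < ν) (hκ : ∀ j, |κ j| ≤ δ)
    (hν : ∀ j, δ ^ 2 + (2 * sin (σ j / 2)) ^ 2 ≤ ν ^ 2) (α α' : ℝ) :
    |∑ q : (Fin 3 → ZMod L) × Fin 3,
        (cos (θ (q.1 + Pi.single q.2 1) + α) * cos (θ q.1 - ϖ q.1 + α') -
          cos (θ (q.1 + Pi.single q.2 1) - ϖ (q.1 + Pi.single q.2 1) + α') * cos (θ q.1 + α)) *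
        m q| ≤ 9 * K * L ^ 3 * ν * δ := by
  set μ : ℝ := ν / δ with hμ
  have hμ0 : 0 < μ := div_pos hν0 hδ0
  have h := H (fun y => μ * cos (θ y + α)) (fun y => cos (θ y - ϖ y + α'))
  have hlhs : (∑ q : (Fin 3 → ZMod L) × Fin 3,
      (μ * cos (θ (q.1 + Pi.single q.2 1) + α) * cos (θ q.1 - ϖ q.1 + α') -
        cos (θ (q.1 + Pi.single q.2 1) - ϖ (q.1 + Pi.single q.2 1) + α') *
          (μ * cos (θ q.1 + α))) * m q) =
      μ * ∑ q : (Fin 3 → ZMod L) × Fin 3,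
        (cos (θ (q.1 + Pi.single q.2 1) + α) * cos (θ q.1 - ϖ q.1 + α') -
          cos (θ (q.1 + Pi.single q.2 1) - ϖ (q.1 + Pi.single q.2 1) + α') * cos (θ q.1 + α)) *
        m q := by
    rw [Finset.mul_sum]
    exact Finset.sum_congr rfl fun q _ => by ring
  rw [hlhs, abs_mul, abs_of_pos hμ0] at h
  have hrhs : ∑ q : (Fin 3 → ZMod L) × Fin 3,
      ((μ * cos (θ q.1 + α) - μ * cos (θ (q.1 + Pi.single q.2 1) + α)) ^ 2 +
        (cos (θ q.1 - ϖ q.1 + α') -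
          cos (θ (q.1 + Pi.single q.2 1) - ϖ (q.1 + Pi.single q.2 1) + α')) ^ 2) ≤
      ((L ^ 3 * 3 : ℕ) : ℝ) * (3 * ν ^ 2) := by
    calc _ ≤ ∑ q : (Fin 3 → ZMod L) × Fin 3, 3 * ν ^ 2 := Finset.sum_le_sum fun q _ => ?_
      _ = ((L ^ 3 * 3 : ℕ) : ℝ) * (3 * ν ^ 2) := by
        rw [Finset.sum_const, Finset.card_univ, card_slice_links, nsmul_eq_mul]
    obtain ⟨y, j⟩ := q
    dsimp only
    rw [cos_add_eq_of_exists_shift (hθ y j) α,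
      cos_add_eq_of_exists_shift (exists_shift_sub hθ hϖ y j) α']
    have e1 : |μ * cos (θ y + α) - μ * cos (θ y + α + κ j)| ≤ ν := by
      rw [← mul_sub, abs_mul, abs_of_pos hμ0]
      calc μ * |cos (θ y + α) - cos (θ y + α + κ j)| ≤ μ * δ :=
            mul_le_mul_of_nonneg_left ((abs_cos_sub_cos_add_le_abs _ _).trans (hκ j)) hμ0.le
        _ = ν := by rw [hμ]; field_simp
    have e2 : |cos (θ y - ϖ y + α') - cos (θ y - ϖ y + α' + (κ j - σ j))| ≤
        δ + 2 * |sin (σ j / 2)| := by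
      refine (abs_cos_sub_cos_add_le _ _).trans ?_
      rw [show (κ j - σ j) / 2 = κ j / 2 - σ j / 2 by ring]
      refine (mul_le_mul_of_nonneg_left (abs_sin_sub_le _ _) two_pos.le).trans ?_
      have h3 : |sin (κ j / 2)| ≤ δ / 2 :=
        abs_sin_le_abs.trans (by rw [abs_div, abs_two]; linarith [hκ j])
      linarith
    have e1' := abs_le.1 e1
    have e2' := abs_le.1 e2
    nlinarith [hν j, sq_nonneg (δ - 2 * |sin (σ j / 2)|), sq_abs (sin (σ j / 2)),
      abs_nonneg (sin (σ j / 2))]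
  have hfin := h.trans (mul_le_mul_of_nonneg_left hrhs hK)
  have hν1 : ν ≠ 0 := hν0.ne'
  have hδ1 : δ ≠ 0 := hδ0.ne'
  calc _ ≤ K * (((L ^ 3 * 3 : ℕ) : ℝ) * (3 * ν ^ 2)) / μ :=
        (le_div_iff₀ hμ0).2 (by rwa [mul_comm] at hfin)
    _ = 9 * K * L ^ 3 * ν * δ := by
        rw [hμ]
        push_cast
        field_simp
        ring

/-- **The momentum-`p` part of the pairing is the mid-link cosine mode.** With `α' = α - π/2`
and the second test at `(α + π/2, α)`, the momentum-`(κ + κ')` parts cancel and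
`T(α, α - π/2) + T(α + π/2, α) = -2 ∑_j sin(κ_j - σ_j/2) ∑_y cos(ϖ(y) + σ_j/2) m(y, j)`.
[cite: Zwanziger1991, Appendix] -/
theorem pairing_add_pairing_eq (m : (Fin 3 → ZMod L) × Fin 3 → ℝ)
    {θ ϖ : (Fin 3 → ZMod L) → ℝ} {κ σ : Fin 3 → ℝ}
    (hθ : ∀ y j, ∃ k : ℤ, θ (y + Pi.single j 1) = θ y + κ j + k * (2 * π))
    (hϖ : ∀ y j, ∃ k : ℤ, ϖ (y + Pi.single j 1) = ϖ y + σ j + k * (2 * π)) (α : ℝ) :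
    (∑ q : (Fin 3 → ZMod L) × Fin 3,
        (cos (θ (q.1 + Pi.single q.2 1) + α) * cos (θ q.1 - ϖ q.1 + (α - π / 2)) -
          cos (θ (q.1 + Pi.single q.2 1) - ϖ (q.1 + Pi.single q.2 1) + (α - π / 2)) *
            cos (θ q.1 + α)) * m q) +
      (∑ q : (Fin 3 → ZMod L) × Fin 3,
        (cos (θ (q.1 + Pi.single q.2 1) + (α + π / 2)) * cos (θ q.1 - ϖ q.1 + α) -
          cos (θ (q.1 + Pi.single q.2 1) - ϖ (q.1 + Pi.single q.2 1) + α) *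
            cos (θ q.1 + (α + π / 2))) * m q) =
      -2 * ∑ j : Fin 3, sin (κ j - σ j / 2) *
        ∑ y : Fin 3 → ZMod L, cos (ϖ y + σ j / 2) * m (y, j) := by
  rw [← Finset.sum_add_distrib, Finset.mul_sum, Fintype.sum_prod_type_right]
  refine Finset.sum_congr rfl fun j _ => ?_
  rw [Finset.mul_sum, Finset.mul_sum]
  refine Finset.sum_congr rfl fun y _ => ?_
  rw [cos_add_eq_of_exists_shift (hθ y j), cos_add_eq_of_exists_shift (exists_shift_sub hθ hϖ y j),
    cos_add_eq_of_exists_shift (hθ y j), cos_add_eq_of_exists_shift (exists_shift_sub hθ hϖ y j)]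
  obtain ⟨s, t, hs, ht⟩ : ∃ s t : ℝ, σ j = s + s ∧ κ j = t + s := ⟨σ j / 2, κ j - σ j / 2, by ring, by ring⟩
  rw [hs, ht, show t + s - (s + s) / 2 = t by ring, show (s + s) / 2 = s by ring,
    show t + s - (s + s) = t - s by ring]
  rw [← add_mul, cos_shift_mul_cos_sub (θ y + α) _ t s,
    cos_shift_mul_cos_sub (θ y + (α + π / 2)) _ t s,
    show θ y + α - (θ y - ϖ y + (α - π / 2)) + s = (ϖ y + s) + π / 2 by ring,
    show θ y + (α + π / 2) - (θ y - ϖ y + α) + s = (ϖ y + s) + π / 2 by ring,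
    show θ y + α + (θ y - ϖ y + (α - π / 2)) + t = (2 * θ y - ϖ y + 2 * α + t) - π / 2 by ring,
    show θ y + (α + π / 2) + (θ y - ϖ y + α) + t = (2 * θ y - ϖ y + 2 * α + t) + π / 2 by ring,
    sin_add_pi_div_two, sin_sub_pi_div_two, sin_add_pi_div_two]
  ring

/-- **Zwanziger's extraction of one polarisation.** Under the FP inequality `H` (for all real
test functions), for `L ≥ 3`, a momentum phase `ϖ` with shift constants `σ_j`, a scale `ν` with
`(2π/L)² + 4 sin²(σ_j/2) ≤ ν²`, and a polarisation `a` with `|cos(σ_a/2)| ≥ 1/2`, the mid-link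
cosine mode satisfies `|∑_y cos(ϖ(y) + σ_a/2) m(y, a)| ≤ 9 K L⁴ ν (2π/L)` (test phases
`θ = ±(2π/L) y_a`, whose weights `sin(κ_j - σ_j/2)` differ only at `j = a`, by
`2 sin(2π/L) cos(σ_a/2)`, and `sin(2π/L) ≥ 2/L`). [cite: Zwanziger1991, Appendix] -/
theorem abs_sum_cos_mul_le (hL : 3 ≤ L) (m : (Fin 3 → ZMod L) × Fin 3 → ℝ) {K : ℝ} (hK : 0 ≤ K)
    (H : ∀ φ ψ : (Fin 3 → ZMod L) → ℝ,
      |∑ q : (Fin 3 → ZMod L) × Fin 3, (φ (q.1 + Pi.single q.2 1) * ψ q.1 -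
          ψ (q.1 + Pi.single q.2 1) * φ q.1) * m q| ≤
        K * ∑ q : (Fin 3 → ZMod L) × Fin 3, ((φ q.1 - φ (q.1 + Pi.single q.2 1)) ^ 2 +
          (ψ q.1 - ψ (q.1 + Pi.single q.2 1)) ^ 2))
    {ϖ : (Fin 3 → ZMod L) → ℝ} {σ : Fin 3 → ℝ}
    (hϖ : ∀ y j, ∃ k : ℤ, ϖ (y + Pi.single j 1) = ϖ y + σ j + k * (2 * π))
    {ν : ℝ} (hν0 : 0 < ν) (hν : ∀ j, (2 * π / L) ^ 2 + (2 * sin (σ j / 2)) ^ 2 ≤ ν ^ 2)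
    (a : Fin 3) (ha : 1 / 2 ≤ |cos (σ a / 2)|) :
    |∑ y : Fin 3 → ZMod L, cos (ϖ y + σ a / 2) * m (y, a)| ≤ 9 * K * L ^ 4 * ν * (2 * π / L) := by
  have hLpos : (0 : ℝ) < L := by exact_mod_cast lt_of_lt_of_le (by norm_num) hL
  set δ : ℝ := 2 * π / L with hδ
  have hδ0 : 0 < δ := by positivity
  set R : Fin 3 → ℝ := fun j => ∑ y : Fin 3 → ZMod L, cos (ϖ y + σ j / 2) * m (y, j) with hR
  -- the test at phase `θ = δ ε y_a`, `ε = ±1`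
  have main : ∀ ε : ℤ, |ε| ≤ 1 →
      |∑ j : Fin 3, sin (δ * ((Pi.single a ε : Fin 3 → ℤ) j) - σ j / 2) * R j| ≤
        9 * K * L ^ 3 * ν * δ := by
    intro ε hε
    set n : Fin 3 → ℤ := Pi.single a ε with hn
    set θ : (Fin 3 → ZMod L) → ℝ := fun y => 2 * π * (∑ i, (n i : ℝ) * ((y i).val : ℝ)) / L
      with hθdef
    have hθ : ∀ y j, ∃ k : ℤ, θ (y + Pi.single j 1) = θ y + δ * n j + k * (2 * π) := by
      intro y j
      obtain ⟨k, hk⟩ := exists_phase_shift n y j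
      exact ⟨k, by rw [hθdef]; dsimp only; rw [hk, hδ]; ring⟩
    have hκ : ∀ j, |δ * n j| ≤ δ := by
      intro j
      rw [abs_mul, abs_of_pos hδ0]
      have : |(n j : ℝ)| ≤ 1 := by
        rw [hn]
        by_cases hja : j = a
        · subst hja; rw [Pi.single_eq_same]; exact_mod_cast hε
        · rw [Pi.single_eq_of_ne hja]; simp
      nlinarith
    have hν' : ∀ j, δ ^ 2 + (2 * sin (σ j / 2)) ^ 2 ≤ ν ^ 2 := hν
    have h1 := abs_pairing_le m hK H hθ hϖ hδ0 hν0 hκ hν' 0 (0 - π / 2)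
    have h2 := abs_pairing_le m hK H hθ hϖ hδ0 hν0 hκ hν' (0 + π / 2) 0
    have h12 := pairing_add_pairing_eq m hθ hϖ 0
    have h3 : |-2 * ∑ j : Fin 3, sin (δ * n j - σ j / 2) * R j| ≤ 2 * (9 * K * L ^ 3 * ν * δ) := by
      rw [← h12]
      exact (abs_add_le _ _).trans (by linarith)
    rw [abs_mul, abs_neg, abs_two] at h3
    linarith
  have hp := main 1 (by norm_num)
  have hm := main (-1) (by norm_num)
  have hdiff : (∑ j : Fin 3, sin (δ * ((Pi.single a (1 : ℤ) : Fin 3 → ℤ) j) - σ j / 2) * R j) -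
      (∑ j : Fin 3, sin (δ * ((Pi.single a (-1 : ℤ) : Fin 3 → ℤ) j) - σ j / 2) * R j) =
      2 * sin δ * cos (σ a / 2) * R a := by
    rw [← Finset.sum_sub_distrib, Finset.sum_eq_single a]
    · rw [Pi.single_eq_same, Pi.single_eq_same, ← sub_mul, sin_sub_sin]
      push_cast
      rw [show (δ * 1 - σ a / 2 - (δ * -1 - σ a / 2)) / 2 = δ by ring,
        show (δ * 1 - σ a / 2 + (δ * -1 - σ a / 2)) / 2 = -(σ a / 2) by ring, cos_neg]
    · intro j _ hja
      rw [Pi.single_eq_of_ne hja, Pi.single_eq_of_ne hja, sub_self]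
    · intro h; exact absurd (Finset.mem_univ a) h
  have h4 : |2 * sin δ * cos (σ a / 2) * R a| ≤ 2 * (9 * K * L ^ 3 * ν * δ) := by
    rw [← hdiff]
    exact (abs_sub _ _).trans (by linarith)
  have hsin : 2 / (L : ℝ) ≤ sin δ := two_div_le_sin_two_pi_div (by exact_mod_cast hL)
  have hsin0 : 0 ≤ sin δ := le_trans (by positivity) hsin
  rw [abs_mul, abs_mul, abs_mul, abs_two, abs_of_nonneg hsin0] at h4
  have hRa : 0 ≤ |R a| := abs_nonneg _
  have h5 : 2 / (L : ℝ) * (1 / 2) * |R a| ≤ sin δ * |cos (σ a / 2)| * |R a| :=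
    mul_le_mul_of_nonneg_right (mul_le_mul hsin ha (by norm_num) hsin0) hRa
  have h6 : |R a| / L ≤ 9 * K * L ^ 3 * ν * δ := by
    have : |R a| / L = 2 / (L : ℝ) * (1 / 2) * |R a| := by ring
    rw [this]
    linarith
  rw [div_le_iff₀ hLpos] at h6
  calc |R a| ≤ 9 * K * L ^ 3 * ν * δ * L := h6
    _ = 9 * K * L ^ 4 * ν * (2 * π / L) := by rw [hδ]; ring

end Extraction

end CoulombFP

end Literature.MathematicalPhysics.QuantumFieldTheory

end
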